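import Literature.NumberTheory.LFunctions.AlternativeHypothesis
import Literature.NumberTheory.LFunctions.SiegelZerosSmallZetaGaps
import HarnessLib

/-!
# The Alternative Hypothesis: Lagarias–Rodgers' form versus the half-integer gap distribution

Topic `Literature/NumberTheory/LFunctions` (namespace `Literature.NumberTheory.LFunctions`). PROOF
LAYER (no new facts), cell `rh-crit/ah` (C5, t5). LABEL: **NOT RH-BEARING** — a bookkeeping
equivalence between two renderings of the same hypothesis; nothing here bears on the truth of RH or
of AH.

Two statements of "consecutive normalised zeros of `ζ` are eventually spaced at half-integers" live
in the tree:

* `AlternativeHypothesisLR` (`AlternativeHypothesis.lean`; Lagarias–Rodgers 2020, §2.3, 2.2, as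
  printed): `γ̃_{j+1} − γ̃_j = h_j + o(1)` with `h_j ∈ {½, 1, 3/2, …}`, for Montgomery's normalised
  ordinates `γ̃_j = γ_j log γ_j / 2π` (`normalizedOrdinate`);
* `HalfIntegerGapDistribution` (`SiegelZerosSmallZetaGaps.lean`; the object refuted on RH + Siegel
  zeros by Bondarenko–Heap 2026, Corollary 2): for every `ε > 0`, eventually the normalised GAP
  `δ_n = (γ_{n+1} − γ_n) log γ_n / 2π` (`zetaNormalizedGap`) is within `ε` of some `k/2`, `k ≥ 1`.

They differ (a) in the normalisation — `γ̃_{n+1} − γ̃_n = δ_n + γ_{n+1} log(γ_{n+1}/γ_n)/2π`, and the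
correction lies in `[0, (γ_{n+1} − γ_n)(1 + (γ_{n+1} − γ_n)/14)/2π]`
(`normalizedOrdinate_sub_sub_zetaNormalizedGap`, `tendsto_normalizedOrdinate_sub_sub_zetaNormalizedGap`)
— and (b) in the quantifier shape (`∃ (k_j)` with a limit, versus `∀ ε ∃ k` eventually; reconciled
by taking `k_n` = the integer nearest `2δ_n`). Hence the two predicates are EQUIVALENT as soon as the
raw gaps `γ_{n+1} − γ_n` tend to `0` (`alternativeHypothesisLR_iff_halfIntegerGapDistribution`).
That input is Littlewood's theorem (1924; Titchmarsh §9.12: every `[T, T + A/log log log T]`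
contains an ordinate, so `γ_{n+1} − γ_n ≪ 1/log log log γ_n → 0`), which is NOT in the tree and is
taken here as an explicit hypothesis, together with the tree's bookkeeping facts `zetaOrdinate_mono`
and `fourteen_lt_zetaOrdinate_zero` (cell rule: "take the gap-tends-to-0 input … as an explicit
hypothesis — never silently", ah/ASSIGNMENTS notes 01:28Z).

## References

* [LagariasRodgers2020] §2.3, 2.2; [BondarenkoHeap2026] Corollary 2 (the `½ℤ + o(1)` distribution);
  [Titchmarsh1986] §9.12 (Littlewood's gap theorem, the hypothesis `hgap`).
-/

noncomputable section

open Filter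
open scoped Real Topology

namespace Literature.NumberTheory.LFunctions

/-- The two normalisations differ by `γ_{n+1} (log γ_{n+1} − log γ_n)/2π`:
`(γ̃_{n+1} − γ̃_n) − δ_n = γ_{n+1}(log γ_{n+1} − log γ_n)/(2π)` (pure algebra). [cite: LagariasRodgers2020, §2.1 (normalized zeros)] -/
theorem normalizedOrdinate_sub_sub_zetaNormalizedGap (n : ℕ) :
    normalizedOrdinate (n + 1) - normalizedOrdinate n - zetaNormalizedGap n =
      zetaOrdinate (n + 1) * (Real.log (zetaOrdinate (n + 1)) - Real.log (zetaOrdinate n)) /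
        (2 * π) := by
  rw [zetaNormalizedGap_eq_mul_div]
  unfold normalizedOrdinate
  ring

/-- If the raw gaps `γ_{n+1} − γ_n` tend to `0` (Littlewood), then `γ̃_{n+1} − γ̃_n − δ_n → 0`: the
correction is `≥ 0` (ordinates non-decreasing) and `≤ (γ_{n+1} − γ_n)(1 + (γ_{n+1} − γ_n)/14)/2π`
(`log x ≤ x − 1`, `γ_n > 14`). [cite: LagariasRodgers2020, §2.1 (normalized zeros)] -/
theorem tendsto_normalizedOrdinate_sub_sub_zetaNormalizedGap (hmono : zetaOrdinate_mono)
    (h14 : fourteen_lt_zetaOrdinate_zero)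
    (hgap : Tendsto (fun n : ℕ ↦ zetaOrdinate (n + 1) - zetaOrdinate n) atTop (𝓝 0)) :
    Tendsto (fun n : ℕ ↦ normalizedOrdinate (n + 1) - normalizedOrdinate n - zetaNormalizedGap n)
      atTop (𝓝 0) := by
  have hγ : ∀ n, 14 < zetaOrdinate n := fun n ↦
    lt_of_lt_of_le (show (14 : ℝ) < zetaOrdinate 0 from h14) (hmono (Nat.zero_le n))
  have hb : Tendsto (fun n : ℕ ↦ (zetaOrdinate (n + 1) - zetaOrdinate n) *
      (1 + (zetaOrdinate (n + 1) - zetaOrdinate n) / 14) / (2 * π)) atTop (𝓝 0) := by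
    have := (hgap.mul (tendsto_const_nhds.add (hgap.div_const 14) :
      Tendsto (fun n : ℕ ↦ 1 + (zetaOrdinate (n + 1) - zetaOrdinate n) / 14) atTop
        (𝓝 (1 + 0 / 14)))).div_const (2 * π)
    simpa using this
  refine squeeze_zero (fun n ↦ ?_) (fun n ↦ ?_) hb
  · rw [normalizedOrdinate_sub_sub_zetaNormalizedGap]
    have h1 : 0 ≤ zetaOrdinate (n + 1) := by linarith [hγ (n + 1)]
    have h2 : Real.log (zetaOrdinate n) ≤ Real.log (zetaOrdinate (n + 1)) :=
      Real.log_le_log (by linarith [hγ n]) (hmono (Nat.le_succ n))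
    exact div_nonneg (mul_nonneg h1 (sub_nonneg.mpr h2)) (by positivity)
  · rw [normalizedOrdinate_sub_sub_zetaNormalizedGap]
    have ha : 14 < zetaOrdinate n := hγ n
    have hb' : 14 < zetaOrdinate (n + 1) := hγ (n + 1)
    have hab : zetaOrdinate n ≤ zetaOrdinate (n + 1) := hmono (Nat.le_succ n)
    have ha0 : zetaOrdinate n ≠ 0 := by linarith
    have hlog : Real.log (zetaOrdinate (n + 1)) - Real.log (zetaOrdinate n) ≤
        (zetaOrdinate (n + 1) - zetaOrdinate n) / zetaOrdinate n := by
      rw [← Real.log_div (by linarith) ha0]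
      have := Real.log_le_sub_one_of_pos (show 0 < zetaOrdinate (n + 1) / zetaOrdinate n by
        positivity)
      rwa [div_sub_one ha0] at this
    have hstep : zetaOrdinate (n + 1) * (Real.log (zetaOrdinate (n + 1)) - Real.log (zetaOrdinate n)) ≤
        (zetaOrdinate (n + 1) - zetaOrdinate n) * (1 + (zetaOrdinate (n + 1) - zetaOrdinate n) / 14) := by
      calc zetaOrdinate (n + 1) * (Real.log (zetaOrdinate (n + 1)) - Real.log (zetaOrdinate n))
          ≤ zetaOrdinate (n + 1) * ((zetaOrdinate (n + 1) - zetaOrdinate n) / zetaOrdinate n) := by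
            gcongr
        _ = (zetaOrdinate (n + 1) - zetaOrdinate n) *
              (1 + (zetaOrdinate (n + 1) - zetaOrdinate n) / zetaOrdinate n) := by
            field_simp
            ring
        _ ≤ (zetaOrdinate (n + 1) - zetaOrdinate n) *
              (1 + (zetaOrdinate (n + 1) - zetaOrdinate n) / 14) := by
            have hsub : 0 ≤ zetaOrdinate (n + 1) - zetaOrdinate n := sub_nonneg.mpr hab
            gcongr
    exact div_le_div_of_nonneg_right hstep (by positivity)

/-- **`AlternativeHypothesisLR ↔ HalfIntegerGapDistribution`, given that the raw gaps
`γ_{n+1} − γ_n` tend to `0`** (Littlewood 1924 / Titchmarsh §9.12, an explicit hypothesis here) and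
the tree's bookkeeping facts on the ordinates. (`→`: `δ_n − k_n/2 = (γ̃_{n+1} − γ̃_n − k_n/2) − D_n`;
`←`: take `k_n` the positive integer nearest `2δ_n`, which for `ε < ¼` is the printed witness.)
[cite: LagariasRodgers2020, §2.3 (2.2)] -/
theorem alternativeHypothesisLR_iff_halfIntegerGapDistribution (hmono : zetaOrdinate_mono)
    (h14 : fourteen_lt_zetaOrdinate_zero)
    (hgap : Tendsto (fun n : ℕ ↦ zetaOrdinate (n + 1) - zetaOrdinate n) atTop (𝓝 0)) :
    AlternativeHypothesisLR ↔ HalfIntegerGapDistribution := by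
  have hD := tendsto_normalizedOrdinate_sub_sub_zetaNormalizedGap hmono h14 hgap
  constructor
  · rintro ⟨k, hk1, hk⟩ ε hε
    have h : Tendsto (fun n : ℕ ↦ zetaNormalizedGap n - (k n : ℝ) / 2) atTop (𝓝 0) := by
      have := hk.sub hD
      rw [sub_zero] at this
      exact this.congr fun n ↦ by ring
    filter_upwards [(Metric.tendsto_nhds.mp h) ε hε] with n hn
    rw [Real.dist_eq, sub_zero] at hn
    exact ⟨k n, hk1 n, hn.le⟩
  · intro h
    refine ⟨fun n ↦ max 1 (round (2 * zetaNormalizedGap n)).toNat, fun n ↦ le_max_left _ _, ?_⟩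
    have hδ : Tendsto (fun n : ℕ ↦ zetaNormalizedGap n -
        ((max 1 (round (2 * zetaNormalizedGap n)).toNat : ℕ) : ℝ) / 2) atTop (𝓝 0) := by
      rw [Metric.tendsto_nhds]
      intro ε hε
      have hε' : 0 < min (ε / 2) (1 / 8) := lt_min (by linarith) (by norm_num)
      filter_upwards [h (min (ε / 2) (1 / 8)) hε'] with n hn
      obtain ⟨k, hk1, hk⟩ := hn
      have hk8 := abs_le.mp (hk.trans (min_le_right _ _))
      have hround : round (2 * zetaNormalizedGap n) = (k : ℤ) := by
        rw [round_eq, Int.floor_eq_iff]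
        push_cast
        constructor <;> linarith [hk8.1, hk8.2]
      have hmax : max 1 (round (2 * zetaNormalizedGap n)).toNat = k := by
        rw [hround, Int.toNat_natCast]
        exact max_eq_right hk1
      rw [hmax, Real.dist_eq, sub_zero]
      exact lt_of_le_of_lt (hk.trans (min_le_left _ _)) (by linarith)
    have := hδ.add hD
    rw [add_zero] at this
    exact this.congr fun n ↦ by ring

end Literature.NumberTheory.LFunctions

end
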